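import Literature.MathematicalPhysics.StatisticalMechanics.ComplexSpinFluctuationFiveSixCertificate
import HarnessLib

/-!
# The Schwinger–Dyson lower bound with the dimer constant: Salmhofer–Seiler's Cor. 4.9 for EVERY `N`

Salmhofer–Seiler (CMP 139 (1991)) prove chiral long-range order for the `U(N)` lattice gauge theory
with one massless staggered fermion at `β = 0` (in its complex-spin form (2.21)) from two inequalities:
the infrared bound (Thm. 3.21, every `N`, Remark 4.5) and the Schwinger–Dyson lower bound (4.38)
`1 ≤ 2m⟨σ_x⟩ + K(N) ∑_{|y-x|=1} ⟨σ_xσ_y⟩`, `K(N) = ∑_k k w_k α_k` (4.39), obtained from the SD equation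
(3.46) and Lemma 4.7 (`⟨(σ_xσ_y)^n⟩ ≤ α_n ⟨σ_xσ_y⟩`).  With `K(1), …, K(4) = 1, 2, 10/3, 83/15` and
`S(4) < 0.35` this gives Cor. 4.9: `1 ≤ N ≤ 4`, `ν ≥ 4` (and `N = 5`, `ν ≥ 5`).

This file proves the SD lower bound with the constant `K(N)` replaced by an arbitrary `c/N` such that
the Taylor data of the bond weight `B(t) = ∑ a_k t^k` satisfy `n a_n ≤ c a_{n-1}` (`1 ≤ n ≤ N`)
(`partitionFunction_le_sd_of_ratio`; for observables `Φ ≥ 0`, `bracket_omega_mul_le_of_ratio`).  The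
proof is (3.44) read on ONE bond: modulo `σ_x^{N+1}`, `N·σσ'W'(σσ')·B(σσ') = σσ'B'(σσ')`
(`euler_bondWeight_left`), and `c·σσ'B(σσ') - σσ'B'(σσ')` has nonnegative coefficients, so the
bond term of (3.46) is `≤ (c/N)[σ_xσ_y Φ]` by the positivity of all other weights (Thm. 3.18(1)).
For the `U(N)` data `a_n = (N-n)! N^{2n}/(N! n!)` one has `n a_n (N-n+1) = N² a_{n-1}`, so `c = N²`:
**`1 ≤ 2m⟨σ_x⟩ + N ∑_{|y-x|=1}⟨σ_xσ_y⟩` for every `N ≥ 1`** (`uN_partitionFunction_le_sharp`) — in the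
monomer–dimer picture of Rossi–Wolff/(3.63) this is the pointwise identity `∑_{y} n_{xy} = N` of the
dimer numbers at `m = 0` together with `⟨σ_xσ_y⟩ = N⁻²⟨n_{xy}(N+1-n_{xy})⟩` and `∑_y n_{xy}² ≤ N²`.
Since `N < K(N)` for `N ≥ 3`, Thm. 4.8's conclusion (4.41)–(4.42) becomes
`c₀ ≥ (1 - 2S(ν))/(4νN)`, positive for EVERY `N` as soon as `S(ν) < 1/2`, i.e. in every `ν ≥ 4` by the
tree's certified `S(ν) < 0.35` (Prop. 4.2(4), `fluctS_lt_of_four_le`):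
**`uN_chiralLRO_allN` — Cor. 4.9 for every `N ≥ 1` and every `ν ≥ 4`** (uniformly in the even
volume; NOT in print for `N ≥ 5` at `ν = 4` / `N ≥ 6`: Salmhofer–Seiler's `K(N)` grows like `N²`).

Also: every bond weight with `a_0 = 1` has Taylor data `w` of `W = N⁻¹ log B` to order `N`
(`logCoeff`, `hasLog_logCoeff`), so the tree's SD equation `schwingerDyson` applies to the `U(N)` data
for every `N` (the tree's explicit `uNLogCoeff` of Remark 4.6 stops at `N = 5`).

Scope (honest): Salmhofer–Seiler's complex spin systems on finite even tori `(ℤ/Lℤ)^ν` at `m = 0`,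
i.e. `U(N)` lattice gauge theory at `β = 0` with ONE staggered fermion in its bosonised form (2.21);
long-range order in the Cesàro form of (4.42).  Nothing about `β > 0`, `SU(N)`, several flavours, the
condensate at `m → 0⁺`, the continuum, or a mass gap.

## References
* [SalmhoferSeiler1991] M. Salmhofer, E. Seiler, Commun. Math. Phys. 139 (1991) 395–432: (2.23),
  Remark 3.2, (3.44)–(3.46), Thm. 3.18(1), Lemma 4.7, Thm. 4.8 (4.38)–(4.42), Cor. 4.9, Prop. 4.2(4).
* [RossiWolff1984] P. Rossi, U. Wolff, Nucl. Phys. B 248 (1984) 105 (the dimer picture of `U(N)` at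
  `β = 0`).
-/

noncomputable section

open MvPolynomial Finset

namespace Literature.MathematicalPhysics.StatisticalMechanics

open Literature.Probability.LatticeModels (TorusSite)

namespace ComplexSpin

variable {ν L : ℕ}

/-! ### Every bond weight with `a_0 = 1` is `exp(NW)` to order `N` -/

/-- **The Taylor data `w_k` of `W = N⁻¹ log B`**, solved recursively from `k a_k = N ∑_{i+j=k} i w_i a_j`
(the coefficient form of `B = exp(NW)`, (3.44)/Remark 3.2): `w_0 = 0` and
`w_k = (k a_k / N - ∑_{i<k} i w_i a_{k-i}) / k` (using `a_0 = 1`).  For the `U(N)` data and `k ≤ 5`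
these are the printed (4.27) (Remark 4.6). [cite: SalmhoferSeiler1991, (3.44) and Remark 4.6] -/
def logCoeff (N : ℕ) (a : ℕ → ℝ) : ℕ → ℝ
  | 0 => 0
  | k + 1 => (((k + 1 : ℕ) : ℝ) * a (k + 1) / N -
      ∑ i : Fin (k + 1), ((i : ℕ) : ℝ) * logCoeff N a i * a (k + 1 - i)) / ((k + 1 : ℕ) : ℝ)
  decreasing_by exact i.2

/-- The recursion solved by `logCoeff`: `(k+1) w_{k+1} + ∑_{i ≤ k} i w_i a_{k+1-i} = (k+1) a_{k+1}/N`.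
[cite: SalmhoferSeiler1991, (3.44)] -/
theorem logCoeff_succ (N : ℕ) (a : ℕ → ℝ) (k : ℕ) :
    (((k + 1 : ℕ) : ℝ)) * logCoeff N a (k + 1) +
        ∑ i ∈ range (k + 1), ((i : ℕ) : ℝ) * logCoeff N a i * a (k + 1 - i) =
      ((k + 1 : ℕ) : ℝ) * a (k + 1) / N := by
  have hk : (((k + 1 : ℕ) : ℝ)) ≠ 0 := by positivity
  rw [logCoeff, ← Fin.sum_univ_eq_sum_range (fun i => ((i : ℕ) : ℝ) * logCoeff N a i * a (k + 1 - i))]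
  field_simp
  ring

/-- **`B = exp(NW)` to order `N` for EVERY bond weight with `B(0) = a_0 = 1`** (`N ≥ 1`): the data
`w = logCoeff N a` satisfy `HasLog N a w`.  Hence the Schwinger–Dyson equation (3.44)/(3.46)
(`schwingerDyson`) holds for every such complex spin system, in particular for the `U(N)` model of
every `N`. [cite: SalmhoferSeiler1991, (3.44) and Remark 3.2] -/
theorem hasLog_logCoeff {N : ℕ} (hN : 1 ≤ N) {a : ℕ → ℝ} (ha0 : a 0 = 1) :
    HasLog N a (logCoeff N a) := by
  intro k hk1 _
  obtain ⟨k, rfl⟩ : ∃ j, k = j + 1 := ⟨k - 1, by omega⟩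
  have hN0 : (N : ℝ) ≠ 0 := by exact_mod_cast (show N ≠ 0 by omega)
  rw [Finset.Nat.sum_antidiagonal_eq_sum_range_succ_mk, Finset.sum_range_succ, Nat.sub_self, ha0,
    mul_one]
  have h := logCoeff_succ N a k
  have h' : ∑ i ∈ range (k + 1), ((i : ℕ) : ℝ) * logCoeff N a i * a (k + 1 - i) =
      ((k + 1 : ℕ) : ℝ) * a (k + 1) / N - ((k + 1 : ℕ) : ℝ) * logCoeff N a (k + 1) := by linarith
  rw [h']
  field_simp
  ring

/-! ### The Euler operator on one bond weight, in terms of the data `a` -/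

section EulerHelpers

variable {σ : Type*}

/-- `σ_z∂_z (c p) = c σ_z∂_z p`. [cite: SalmhoferSeiler1991, (3.45)] -/
private theorem euler_C_mul'' (z : σ) (c : ℝ) (p : MvPolynomial σ ℝ) :
    euler z (C c * p) = C c * euler z p := by
  unfold euler
  rw [pderiv_C_mul]
  ring

/-- `σ_z∂_z` commutes with finite sums. [cite: SalmhoferSeiler1991, (3.45)] -/
private theorem euler_finset_sum'' (z : σ) {ι : Type*} (s : Finset ι) (f : ι → MvPolynomial σ ℝ) :
    euler z (∑ i ∈ s, f i) = ∑ i ∈ s, euler z (f i) := by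
  unfold euler
  rw [map_sum, Finset.mul_sum]

/-- `σ_x∂_x (σ_xσ_y)^k = k (σ_xσ_y)^k` for `x ≠ y`. [cite: SalmhoferSeiler1991, (3.46)] -/
private theorem euler_XX_pow'' [DecidableEq σ] {x y : σ} (hxy : x ≠ y) (k : ℕ) :
    euler x ((X x * X y : MvPolynomial σ ℝ) ^ k) = C (k : ℝ) * (X x * X y) ^ k := by
  have hm : (X x * X y : MvPolynomial σ ℝ) ^ k =
      monomial (Finsupp.single x k + Finsupp.single y k) 1 := by
    rw [mul_pow, X_pow_eq_monomial, X_pow_eq_monomial, monomial_mul, mul_one]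
  rw [hm, euler_monomial, Finsupp.add_apply, Finsupp.single_eq_same, Finsupp.single_eq_of_ne hxy,
    add_zero]

/-- A product with a high factor has no `∏_x σ_x^N` coefficient ("`σ_z^{N+1}` in the numerator").
[cite: SalmhoferSeiler1991, proof of (3.44)] -/
private theorem coeff_mul_eq_zero_of_highDeg {N : ℕ} {z : σ} {p : MvPolynomial σ ℝ}
    (hp : HighDeg N z p) (q : MvPolynomial σ ℝ) {d : σ →₀ ℕ} (hd : d z = N) :
    coeff d (p * q) = 0 := by
  classical
  rw [coeff_mul]
  refine Finset.sum_eq_zero fun e he => ?_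
  by_cases h1 : coeff e.1 p = 0
  · rw [h1, zero_mul]
  · exfalso
    have hlt := hp e.1 h1
    have he' : e.1 + e.2 = d := by simpa [Finset.mem_antidiagonal] using he
    have : e.1 z ≤ d z := by rw [← he', Finsupp.add_apply]; omega
    omega

end EulerHelpers

/-- **`σ_xσ_y B'(σ_xσ_y)` in terms of the data**: `σ_x∂_x B(σ_xσ_y) = ∑_k k a_k (σ_xσ_y)^k` (`x ≠ y`).
[cite: SalmhoferSeiler1991, (3.44)] -/
theorem euler_bondWeight_eq_sum (N : ℕ) (a : ℕ → ℝ) {x y : TorusSite ν L} (hxy : x ≠ y) :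
    euler x (bondWeight N a x y) = ∑ k ∈ range (N + 1), C ((k : ℝ) * a k) * (X x * X y) ^ k := by
  classical
  unfold bondWeight
  rw [euler_finset_sum'']
  refine Finset.sum_congr rfl fun k _ => ?_
  rw [euler_C_mul'', euler_XX_pow'' hxy, ← mul_assoc, ← map_mul, mul_comm (a k)]

/-- **The one-bond comparison polynomial**: for data with `n a_n ≤ c a_{n-1}` (`1 ≤ n ≤ N`),
`c·σσ'·B(σσ') = σσ'B'(σσ') + D` with `D` a polynomial with NONNEGATIVE coefficients
(`D = ∑_{n=1}^{N} (c a_{n-1} - n a_n)(σσ')^n + c a_N (σσ')^{N+1}`). [cite: SalmhoferSeiler1991, (3.44) with (2.23)] -/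
theorem C_mul_XX_mul_bondWeight_eq (N : ℕ) (a : ℕ → ℝ) (c : ℝ) (x y : TorusSite ν L) :
    C c * (X x * X y) * bondWeight N a x y =
      (∑ k ∈ range (N + 1), C ((k : ℝ) * a k) * (X x * X y) ^ k) +
        ((∑ k ∈ range N, C (c * a k - ((k + 1 : ℕ) : ℝ) * a (k + 1)) * (X x * X y) ^ (k + 1)) +
          C (c * a N) * (X x * X y) ^ (N + 1)) := by
  set T : MvPolynomial (TorusSite ν L) ℝ := X x * X y with hT
  unfold bondWeight
  rw [← hT, Finset.mul_sum, Finset.sum_range_succ (fun k => C c * T * (C (a k) * T ^ k)) N,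
    Finset.sum_range_succ' (fun k => C ((k : ℝ) * a k) * T ^ k) N]
  simp only [Nat.cast_zero, zero_mul, C_0, add_zero, pow_zero]
  have hterm : ∀ k : ℕ, C c * T * (C (a k) * T ^ k) = C (c * a k) * T ^ (k + 1) := by
    intro k; rw [map_mul, pow_succ]; ring
  simp_rw [hterm]
  rw [← add_assoc, ← Finset.sum_add_distrib]
  have hpair : ∀ k : ℕ, C (((k + 1 : ℕ) : ℝ) * a (k + 1)) * T ^ (k + 1) +
      C (c * a k - ((k + 1 : ℕ) : ℝ) * a (k + 1)) * T ^ (k + 1) = C (c * a k) * T ^ (k + 1) := by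
    intro k
    rw [← add_mul, ← map_add]
    congr 2
    ring
  simp_rw [hpair]

/-- The comparison polynomial `D` has nonnegative coefficients when `a_N ≥ 0`, `c ≥ 0` and
`n a_n ≤ c a_{n-1}` for `1 ≤ n ≤ N`. [cite: SalmhoferSeiler1991, (2.23) and Thm. 3.18(1)] -/
theorem nonnegCoeff_comparison (N : ℕ) {a : ℕ → ℝ} (haN : 0 ≤ a N) {c : ℝ} (hc0 : 0 ≤ c)
    (hc : ∀ n, 1 ≤ n → n ≤ N → (n : ℝ) * a n ≤ c * a (n - 1)) (x y : TorusSite ν L) :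
    NonnegCoeff ((∑ k ∈ range N, C (c * a k - ((k + 1 : ℕ) : ℝ) * a (k + 1)) * (X x * X y) ^ (k + 1)) +
      C (c * a N) * (X x * X y) ^ (N + 1)) := by
  have hT : NonnegCoeff (X x * X y : MvPolynomial (TorusSite ν L) ℝ) :=
    (NonnegCoeff.X x).mul (NonnegCoeff.X y)
  refine (NonnegCoeff.sum _ fun k hk => ?_).add ((NonnegCoeff.C (mul_nonneg hc0 haN)).mul (hT.pow _))
  have hk' : k < N := Finset.mem_range.mp hk
  refine (NonnegCoeff.C ?_).mul (hT.pow _)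
  have := hc (k + 1) (by omega) (by omega)
  rw [Nat.add_sub_cancel] at this
  linarith

/-! ### The torus bond at `x` in direction `s`, and the Boltzmann polynomial with it factored out -/

/-- On a torus of side `L ≥ 2`, `x + e_μ ≠ x`. [cite: SalmhoferSeiler1991, §2 (2.1)] -/
private theorem add_single_ne_self' (hL : 2 ≤ L) (x : TorusSite ν L) (μ : Fin ν) :
    x + Pi.single μ (1 : ZMod L) ≠ x := by
  haveI : Fact (1 < L) := ⟨hL⟩
  intro h
  have h1 : (Pi.single μ (1 : ZMod L) : TorusSite ν L) = 0 := by
    have := congrArg (fun y => y - x) h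
    simp only [add_sub_cancel_left, sub_self] at this
    exact this
  have := congrFun h1 μ
  simp at this

/-- A neighbour `x ± e_μ` differs from `x` (side `L ≥ 2`). [cite: SalmhoferSeiler1991, (3.46)] -/
theorem nbr_ne_self (hL : 2 ≤ L) (x : TorusSite ν L) (s : Fin ν × Bool) : x ≠ nbr x s := by
  unfold nbr
  split_ifs
  · exact (add_single_ne_self' hL x s.1).symm
  · intro h
    have := add_single_ne_self' hL (x - Pi.single s.1 1) s.1
    rw [sub_add_cancel] at this
    exact this h

/-- The link of the enumeration `(x', μ) ↦ (x', x'+e_μ)` carrying the bond `{x, nbr x s}`.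
[cite: SalmhoferSeiler1991, (2.21)] -/
def linkOf (x : TorusSite ν L) (s : Fin ν × Bool) : TorusSite ν L × Fin ν :=
  if s.2 then (x, s.1) else (x - Pi.single s.1 1, s.1)

/-- The weight on the link `linkOf x s` is `B(σ_x σ_{nbr x s})`. [cite: SalmhoferSeiler1991, (2.21)] -/
theorem bondWeight_linkOf (N : ℕ) (a : ℕ → ℝ) (x : TorusSite ν L) (s : Fin ν × Bool) :
    bondWeight N a (linkOf x s).1 ((linkOf x s).1 + Pi.single (linkOf x s).2 1) =
      bondWeight N a x (nbr x s) := by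
  unfold linkOf nbr
  rcases s with ⟨μ, b⟩
  cases b
  · simp only [Bool.false_eq_true, if_false, sub_add_cancel]
    exact bondWeight_comm N a _ _
  · simp only [if_true]

/-- The Boltzmann polynomial with the weight of the bond `{x, nbr x s}` factored out:
`∏F ∏B = B(σ_xσ_{x±e_μ}) · R`, `R` = the product of all site weights and all OTHER bond weights.
[cite: SalmhoferSeiler1991, (2.21) and Def. 3.1] -/
theorem boltzmann_eq_bondWeight_mul [NeZero L] (N : ℕ) (m : ℝ) (a : ℕ → ℝ) (x : TorusSite ν L)
    (s : Fin ν × Bool) :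
    boltzmann N m a = bondWeight N a x (nbr x s) *
      ((∏ z : TorusSite ν L, siteWeight N m z) *
        ∏ p ∈ Finset.univ.erase (linkOf x s), bondWeight N a p.1 (p.1 + Pi.single p.2 1)) := by
  unfold boltzmann
  have hprod : (∏ z : TorusSite ν L, ∏ μ : Fin ν, bondWeight N a z (z + Pi.single μ 1)) =
      ∏ p : TorusSite ν L × Fin ν, bondWeight N a p.1 (p.1 + Pi.single p.2 1) := by
    rw [Fintype.prod_prod_type]
  have hsplit : (∏ p : TorusSite ν L × Fin ν, bondWeight N a p.1 (p.1 + Pi.single p.2 1)) =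
      bondWeight N a x (nbr x s) *
        ∏ p ∈ Finset.univ.erase (linkOf x s), bondWeight N a p.1 (p.1 + Pi.single p.2 1) := by
    rw [← bondWeight_linkOf]
    exact (Finset.mul_prod_erase (Finset.univ) (fun p : TorusSite ν L × Fin ν =>
      bondWeight N a p.1 (p.1 + Pi.single p.2 1)) (Finset.mem_univ (linkOf x s))).symm
  rw [hprod, hsplit]
  ring

/-- The cofactor `R` has nonnegative coefficients (`m ≥ 0`, `a_k ≥ 0`). [cite: SalmhoferSeiler1991, Thm. 3.18(1)] -/
theorem nonnegCoeff_cofactor [NeZero L] (N : ℕ) {m : ℝ} (hm : 0 ≤ m) {a : ℕ → ℝ}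
    (ha : ∀ k ≤ N, 0 ≤ a k) (x : TorusSite ν L) (s : Fin ν × Bool) :
    NonnegCoeff ((∏ z : TorusSite ν L, siteWeight N m z) *
        ∏ p ∈ Finset.univ.erase (linkOf x s), bondWeight N a p.1 (p.1 + Pi.single p.2 1)) :=
  (NonnegCoeff.prod _ fun z _ => nonnegCoeff_siteWeight N hm z).mul
    (NonnegCoeff.prod _ fun p _ => nonnegCoeff_bondWeight N ha p.1 _)

/-! ### The sharp one-bond Schwinger–Dyson inequality -/

variable [NeZero L]
set_option maxHeartbeats 400000 in
/-- **The one-bond Schwinger–Dyson term with the dimer constant.**  Let `B = exp(NW)` to order `N`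
(`HasLog N a w`, ANY `w`), `a_0 = 1`, `a_k ≥ 0`, and `n a_n ≤ c a_{n-1}` for `1 ≤ n ≤ N`; `m ≥ 0`,
side `L ≥ 2`.  Then for every observable `Φ` with nonnegative coefficients and every bond `{x, y}`,
`y = x ± e_μ`:  `N [σ_xσ_y W'(σ_xσ_y) Φ]_Λ ≤ c [σ_xσ_y Φ]_Λ`, i.e.
`∑_k k w_k [(σ_xσ_y)^k Φ] ≤ (c/N) [σ_xσ_y Φ]` — Lemma 4.7's role in (4.38), with `K(N)` replaced by
`c/N`. [cite: SalmhoferSeiler1991, (3.44)–(3.46), Lemma 4.7 and (4.38)] -/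
theorem bracket_omega_mul_le_of_ratio {N : ℕ} {a w : ℕ → ℝ} (hlog : HasLog N a w) (ha0 : a 0 = 1)
    (ha : ∀ k ≤ N, 0 ≤ a k) {c : ℝ} (hc : ∀ n, 1 ≤ n → n ≤ N → (n : ℝ) * a n ≤ c * a (n - 1))
    (hL : 2 ≤ L) {m : ℝ} (hm : 0 ≤ m) (x : TorusSite ν L) (s : Fin ν × Bool)
    {Φ : MvPolynomial (TorusSite ν L) ℝ} (hΦ : NonnegCoeff Φ) :
    (N : ℝ) * bracket N m a (omega N w x (nbr x s) * Φ) ≤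
      c * bracket N m a (X x * X (nbr x s) * Φ) := by
  set y := nbr x s with hy
  have hxy : x ≠ y := nbr_ne_self hL x s
  set T : MvPolynomial (TorusSite ν L) ℝ := X x * X y with hT
  set R := (∏ z : TorusSite ν L, siteWeight N m z) *
    ∏ p ∈ Finset.univ.erase (linkOf x s), bondWeight N a p.1 (p.1 + Pi.single p.2 1) with hR
  have hRnn : NonnegCoeff R := nonnegCoeff_cofactor N hm ha x s
  have hbolt : boltzmann N m a = bondWeight N a x y * R := boltzmann_eq_bondWeight_mul N m a x s
  -- `c ≥ 0` (from `n = 1`: `a_1 ≤ c a_0 = c`, or vacuously when `N = 0` … we need `N ≥ 1` only through `hc`)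
  rcases Nat.eq_zero_or_pos N with hN0 | hNpos
  · -- `N = 0`: the left side is `0`
    subst hN0
    have hω : omega 0 w x y = 0 := by
      unfold omega
      simp
    rw [hω, zero_mul, bracket_zero, Nat.cast_zero, zero_mul]
    have hc0 : 0 ≤ c * bracket 0 m a (T * Φ) := by
      -- with `N = 0` the hypothesis `hc` is vacuous; but `[σ_xσ_y Φ]_Λ = 0` since `σ_x` has degree `> 0 = N`
      have hhigh : HighDeg 0 x (T * Φ) := by
        intro d hd
        rw [hT, mul_assoc, coeff_X_mul'] at hd
        split_ifs at hd with hx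
        · exact Nat.pos_of_ne_zero (Finsupp.mem_support_iff.mp hx)
        · exact (hd rfl).elim
      rw [bracket_eq_zero_of_highDeg m a hhigh, mul_zero]
    exact hc0
  have hc0 : 0 ≤ c := by
    have h1 := hc 1 le_rfl hNpos
    rw [Nat.sub_self, ha0, mul_one, Nat.cast_one, one_mul] at h1
    exact (ha 1 hNpos).trans h1
  -- Euler on the bond weight: `N ω B = σσ'B' - h`, `h` high
  obtain ⟨h, hh, hE⟩ := euler_bondWeight_left (ν := ν) (L := L) hlog hxy
  rw [euler_bondWeight_eq_sum N a hxy] at hE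
  -- `N [ω Φ] = coeff_top ((N ω B) Φ R)`
  have h1 : (N : ℝ) * bracket N m a (omega N w x y * Φ) =
      coeff (topExponent N) ((C (N : ℝ) * omega N w x y * bondWeight N a x y) * (Φ * R)) := by
    rw [← bracket_C_mul, bracket, hbolt]
    congr 1
    ring
  have h2 : C (N : ℝ) * omega N w x y * bondWeight N a x y =
      (∑ k ∈ range (N + 1), C ((k : ℝ) * a k) * T ^ k) - h := by
    rw [hT]
    linear_combination -hE
  have h3 : coeff (topExponent N) (h * (Φ * R)) = 0 :=
    coeff_mul_eq_zero_of_highDeg hh _ (topExponent_apply' N x)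
  -- `σσ'B' = c σσ' B - D`
  have h4 : (∑ k ∈ range (N + 1), C ((k : ℝ) * a k) * T ^ k) =
      C c * T * bondWeight N a x y -
        ((∑ k ∈ range N, C (c * a k - ((k + 1 : ℕ) : ℝ) * a (k + 1)) * T ^ (k + 1)) +
          C (c * a N) * T ^ (N + 1)) := by
    rw [hT, C_mul_XX_mul_bondWeight_eq N a c x y]
    ring
  have hD : NonnegCoeff ((∑ k ∈ range N, C (c * a k - ((k + 1 : ℕ) : ℝ) * a (k + 1)) * T ^ (k + 1)) +
      C (c * a N) * T ^ (N + 1)) := nonnegCoeff_comparison N (ha N le_rfl) hc0 hc x y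
  have h5 : 0 ≤ coeff (topExponent N)
      (((∑ k ∈ range N, C (c * a k - ((k + 1 : ℕ) : ℝ) * a (k + 1)) * T ^ (k + 1)) +
        C (c * a N) * T ^ (N + 1)) * (Φ * R)) := (hD.mul (hΦ.mul hRnn)) _
  have h6 : coeff (topExponent N) (C c * T * bondWeight N a x y * (Φ * R)) =
      c * bracket N m a (T * Φ) := by
    rw [bracket, hbolt, ← coeff_C_mul]
    congr 1
    ring
  rw [h1, h2, sub_mul, coeff_sub, h3, sub_zero, h4, sub_mul, coeff_sub, h6]
  linarith

/-- **(4.38) with the dimer constant.**  Under the same hypotheses, at every site `x`: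
`Z_Λ ≤ 2m [σ_x]_Λ + (c/N) ∑_{|y-x|=1} [σ_xσ_y]_Λ`, i.e. `1 ≤ 2m⟨σ_x⟩ + (c/N)∑_{|y-x|=1}⟨σ_xσ_y⟩`.
[cite: SalmhoferSeiler1991, (3.46) and (4.38)] -/
theorem partitionFunction_le_sd_of_ratio {N : ℕ} (hN : 1 ≤ N) {a w : ℕ → ℝ} (hlog : HasLog N a w)
    (ha0 : a 0 = 1) (ha : ∀ k ≤ N, 0 ≤ a k) {c : ℝ}
    (hc : ∀ n, 1 ≤ n → n ≤ N → (n : ℝ) * a n ≤ c * a (n - 1)) (hL : 2 ≤ L) {m : ℝ} (hm : 0 ≤ m)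
    (x : TorusSite ν L) :
    partitionFunction (ν := ν) (L := L) N m a ≤
      2 * m * bracket N m a (X x) + c / N * ∑ s : Fin ν × Bool, bracket N m a (X x * X (nbr x s)) := by
  have hNpos : (0 : ℝ) < N := Nat.cast_pos.mpr hN
  rw [partitionFunction_eq_sd hN hlog hL m x, linkSum_eq_sum_nbr, bracket_sum, Finset.mul_sum]
  refine add_le_add_right (Finset.sum_le_sum fun s _ => ?_) _
  have h := bracket_omega_mul_le_of_ratio hlog ha0 ha hc hL hm x s NonnegCoeff.one
  rw [mul_one, mul_one] at h
  rw [div_mul_eq_mul_div, le_div_iff₀ hNpos, mul_comm]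
  exact h

/-! ### The `U(N)` model: `n a_n (N - n + 1) = N² a_{n-1}`, hence `c = N²` and the constant `N` -/

/-- The `U(N)` bond data are nonnegative. [cite: SalmhoferSeiler1991, (2.23)] -/
theorem uNBondCoeff_nonneg (N k : ℕ) : 0 ≤ uNBondCoeff N k := by
  unfold uNBondCoeff
  split_ifs
  · positivity
  · exact le_rfl

/-- The top `U(N)` coefficient is positive: `a_N = N^{2N}/(N!)² > 0`. [cite: SalmhoferSeiler1991, (2.23)] -/
theorem uNBondCoeff_self_pos (N : ℕ) : 0 < uNBondCoeff N N := by
  unfold uNBondCoeff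
  rw [if_pos le_rfl]
  rcases Nat.eq_zero_or_pos N with rfl | hN
  · simp
  · positivity

/-- **The ratio of consecutive `U(N)` coefficients**: `n a_n (N-n+1) = N² a_{n-1}` for `1 ≤ n ≤ N`
(`a_n/a_{n-1} = N²/(n(N-n+1))`; in the dimer picture, adding the `n`-th dimer to a bond costs
`1/(n(N-n+1))`). [cite: SalmhoferSeiler1991, (2.23)] -/
theorem uNBondCoeff_ratio {N n : ℕ} (hn1 : 1 ≤ n) (hnN : n ≤ N) :
    (n : ℝ) * uNBondCoeff N n * ((N - n + 1 : ℕ) : ℝ) = (N : ℝ) ^ 2 * uNBondCoeff N (n - 1) := by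
  obtain ⟨j, rfl⟩ : ∃ j, n = j + 1 := ⟨n - 1, by omega⟩
  obtain ⟨r, rfl⟩ : ∃ r, N = j + 1 + r := ⟨N - (j + 1), by omega⟩
  unfold uNBondCoeff
  rw [if_pos hnN, if_pos (by omega), show j + 1 + r - (j + 1) = r by omega,
    show j + 1 - 1 = j by omega, show j + 1 + r - j = r + 1 by omega,
    Nat.factorial_succ j, Nat.factorial_succ r]
  have hf1 : ((Nat.factorial (j + 1 + r) : ℕ) : ℝ) ≠ 0 := by positivity
  have hf2 : ((Nat.factorial j : ℕ) : ℝ) ≠ 0 := by positivity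
  have hf3 : ((Nat.factorial r : ℕ) : ℝ) ≠ 0 := by positivity
  push_cast
  field_simp
  ring

/-- **`n a_n ≤ N² a_{n-1}`** for the `U(N)` data, `1 ≤ n ≤ N`. [cite: SalmhoferSeiler1991, (2.23)] -/
theorem uNBondCoeff_mul_le {N n : ℕ} (hn1 : 1 ≤ n) (hnN : n ≤ N) :
    (n : ℝ) * uNBondCoeff N n ≤ (N : ℝ) ^ 2 * uNBondCoeff N (n - 1) := by
  rw [← uNBondCoeff_ratio hn1 hnN]
  have h0 : 0 ≤ (n : ℝ) * uNBondCoeff N n := mul_nonneg (Nat.cast_nonneg n) (uNBondCoeff_nonneg N n)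
  have h1 : (1 : ℝ) ≤ ((N - n + 1 : ℕ) : ℝ) := by exact_mod_cast (show 1 ≤ N - n + 1 by omega)
  nlinarith

/-- **The Schwinger–Dyson lower bound for `U(N)`, every `N ≥ 1`, with the constant `N`**:
`Z_Λ ≤ 2m[σ_x]_Λ + N ∑_{|y-x|=1}[σ_xσ_y]_Λ`, i.e. `1 ≤ 2m⟨σ_x⟩ + N ∑_{|y-x|=1}⟨σ_xσ_y⟩` (`m ≥ 0`,
side `L ≥ 2`) — (4.38) with `K(N)` (`= 1, 2, 10/3, 83/15, …`) replaced by `N`.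
[cite: SalmhoferSeiler1991, (4.38)–(4.39) with (2.23)] -/
theorem uN_partitionFunction_le_sharp {N : ℕ} (hN : 1 ≤ N) (hL : 2 ≤ L) {m : ℝ} (hm : 0 ≤ m)
    (x : TorusSite ν L) :
    partitionFunction (ν := ν) (L := L) N m (uNBondCoeff N) ≤
      2 * m * bracket N m (uNBondCoeff N) (X x) +
        N * ∑ s : Fin ν × Bool, bracket N m (uNBondCoeff N) (X x * X (nbr x s)) := by
  have h := partitionFunction_le_sd_of_ratio hN (hasLog_logCoeff hN (uNBondCoeff_zero N))
    (uNBondCoeff_zero N) (fun k _ => uNBondCoeff_nonneg N k) (c := (N : ℝ) ^ 2)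
    (fun n hn1 hnN => uNBondCoeff_mul_le hn1 hnN) hL hm x
  have hN0 : (N : ℝ) ≠ 0 := by exact_mod_cast (show N ≠ 0 by omega)
  rwa [show (N : ℝ) ^ 2 / N = N by rw [pow_two, mul_div_assoc, div_self hN0, mul_one]] at h

/-- The same for observables: `∑_k k w_k [(σ_xσ_y)^k Φ] ≤ N [σ_xσ_y Φ]` for `Φ ≥ 0` coefficientwise and
ANY Taylor data `w` of `N⁻¹ log B` (Lemma 4.7's role, with `α`'s replaced by the dimer constant).
[cite: SalmhoferSeiler1991, Lemma 4.7 with (2.23)] -/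
theorem uN_bracket_omega_mul_le {N : ℕ} {w : ℕ → ℝ} (hlog : HasLog N (uNBondCoeff N) w)
    (hL : 2 ≤ L) {m : ℝ} (hm : 0 ≤ m) (x : TorusSite ν L) (s : Fin ν × Bool)
    {Φ : MvPolynomial (TorusSite ν L) ℝ} (hΦ : NonnegCoeff Φ) :
    bracket N m (uNBondCoeff N) (omega N w x (nbr x s) * Φ) ≤
      N * bracket N m (uNBondCoeff N) (X x * X (nbr x s) * Φ) := by
  have h := bracket_omega_mul_le_of_ratio hlog (uNBondCoeff_zero N) (fun k _ => uNBondCoeff_nonneg N k)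
    (c := (N : ℝ) ^ 2) (fun n hn1 hnN => uNBondCoeff_mul_le hn1 hnN) hL hm x s hΦ
  rcases Nat.eq_zero_or_pos N with rfl | hN
  · simp only [Nat.cast_zero, zero_mul, pow_succ, mul_zero] at h ⊢
    have hω : omega (ν := ν) (L := L) 0 w x (nbr x s) = 0 := by unfold omega; simp
    rw [hω, zero_mul, bracket_zero]
  · have hNpos : (0 : ℝ) < N := Nat.cast_pos.mpr hN
    rw [pow_two, mul_assoc] at h
    exact le_of_mul_le_mul_left h hNpos

/-! ### Thm. 4.8 (4.41)–(4.42) with the Schwinger–Dyson constant as a parameter -/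

/-- **Thm. 4.8 (4.41)–(4.42), unnormalised, with the SD constant as a parameter.**  Complex spin system
on the even torus `(ℤ/Lℤ)^ν` (`ν ≥ 1`) at `m = 0` with `a_k ≥ 0` and `b_k ≥ 0` (the infrared bound's
hypothesis (3.73)); if `Z_Λ ≤ K ∑_{|y|=1}[σ_0σ_y]_Λ` for some `K > 0` (the SD lower bound (4.38) with
constant `K`), then `|Λ|⁻¹∑_x [σ_0σ_x]_Λ ≥ (Z_Λ/4ν)(1/K - 2S_Λ(ν)/N)` — (4.40)–(4.41) verbatim with `K`
for `K(N)`. [cite: SalmhoferSeiler1991, Thm. 4.8 ((4.38)–(4.42))] -/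
theorem chiralLRO_bracket_of_sd (hν : 1 ≤ ν) (hL : Even L) {N : ℕ} (hN : 1 ≤ N)
    {a : ℕ → ℝ} (ha : ∀ k ≤ N, 0 ≤ a k) (hb : ∀ k ≤ N, 0 ≤ fluctCoeff N a k) {K : ℝ} (hK : 0 < K)
    (hsd : partitionFunction (ν := ν) (L := L) N 0 a ≤
      K * ∑ s : Fin ν × Bool, bracket N 0 a (X (0 : TorusSite ν L) * X (nbr 0 s))) :
    partitionFunction (ν := ν) (L := L) N 0 a / (4 * ν) * (1 / K - 2 * latticeS ν L / N) ≤
      (Fintype.card (TorusSite ν L) : ℝ)⁻¹ *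
        ∑ x : TorusSite ν L, bracket N 0 a (X (0 : TorusSite ν L) * X x) := by
  set Z := partitionFunction (ν := ν) (L := L) N 0 a with hZ
  set S := latticeS ν L with hS
  set n : ℝ := (Fintype.card (TorusSite ν L) : ℝ) with hn
  set g0 := ∑ x : TorusSite ν L, bracket N 0 a (X (0 : TorusSite ν L) * X x) with hg0
  have hNpos : (0 : ℝ) < N := Nat.cast_pos.mpr hN
  have hνpos : (0 : ℝ) < ν := Nat.cast_pos.mpr hν
  have hnpos : 0 < n := Nat.cast_pos.2 Fintype.card_pos
  have hZ0 : 0 ≤ Z := partitionFunction_nonneg_of_coeff N le_rfl ha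
  rw [sum_bracket_nbr_zero] at hsd
  -- (4.40) and `ĝ(π̂) = -ĝ(0)`
  have h40 := sum_twoPt_nbr_le hν hL hN 0 hb
  rw [twoPtHat_stagChar_zero_mass hL.two_dvd hν, sub_neg_eq_add] at h40
  have hg : twoPtHat N 0 a (0 : AddChar (TorusSite ν L) ℂ) = g0 := by
    simp [twoPtHat, kernelSymbol, twoPt, hg0, Complex.re_sum]
  rw [hg, ← hZ, ← hS, ← hn] at h40
  have hcomb : Z ≤ K * (2 * ν / n * (g0 + g0) + 2 / N * Z * S) :=
    hsd.trans (mul_le_mul_of_nonneg_left h40 hK.le)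
  rw [div_mul_eq_mul_div, div_le_iff₀ (by positivity : (0 : ℝ) < 4 * ν)]
  have h1 : Z * (1 / K - 2 * S / N) = (Z - K * (2 / N * Z * S)) / K := by
    field_simp
  rw [h1, div_le_iff₀ hK]
  have h2 : K * (2 * ν / n * (g0 + g0)) = n⁻¹ * g0 * (4 * ν) * K := by
    field_simp
    ring
  nlinarith [hcomb, h2]

/-- **Thm. 4.8 (4.42), normalised, with the SD constant as a parameter**: under the hypotheses of
`chiralLRO_bracket_of_sd` and `Z_Λ > 0`, `|Λ|⁻¹∑_x⟨σ_0σ_x⟩_Λ ≥ (1/4ν)(1/K - 2S_Λ(ν)/N)`.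
[cite: SalmhoferSeiler1991, Thm. 4.8 ((4.41)–(4.42))] -/
theorem chiralLRO_expect_of_sd (hν : 1 ≤ ν) (hL : Even L) {N : ℕ} (hN : 1 ≤ N)
    {a : ℕ → ℝ} (ha : ∀ k ≤ N, 0 ≤ a k) (hb : ∀ k ≤ N, 0 ≤ fluctCoeff N a k)
    (hZ : 0 < partitionFunction (ν := ν) (L := L) N 0 a) {K : ℝ} (hK : 0 < K)
    (hsd : partitionFunction (ν := ν) (L := L) N 0 a ≤
      K * ∑ s : Fin ν × Bool, bracket N 0 a (X (0 : TorusSite ν L) * X (nbr 0 s))) :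
    1 / (4 * ν) * (1 / K - 2 * latticeS ν L / N) ≤
      (Fintype.card (TorusSite ν L) : ℝ)⁻¹ *
        ∑ x : TorusSite ν L, expect N 0 a (X (0 : TorusSite ν L) * X x) := by
  have h := chiralLRO_bracket_of_sd hν hL hN ha hb hK hsd
  simp_rw [expect_eq_div, div_eq_mul_inv]
  rw [← Finset.sum_mul]
  rw [← mul_le_mul_iff_of_pos_right hZ]
  calc 1 / (4 * ν) * (1 / K - 2 * latticeS ν L / N) * partitionFunction N 0 a
      = partitionFunction N 0 a / (4 * ν) * (1 / K - 2 * latticeS ν L / N) := by ring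
    _ ≤ (Fintype.card (TorusSite ν L) : ℝ)⁻¹ *
          ∑ x : TorusSite ν L, bracket N 0 a (X (0 : TorusSite ν L) * X x) := h
    _ = (Fintype.card (TorusSite ν L) : ℝ)⁻¹ *
          ((∑ x : TorusSite ν L, bracket N 0 a (X (0 : TorusSite ν L) * X x)) *
            (partitionFunction N 0 a)⁻¹) * partitionFunction N 0 a := by
        field_simp

/-- **Thm. 4.8 (4.42) for `U(N)`, EVERY `N ≥ 1`, with the dimer constant, in finite volume**:
on the even torus `(ℤ/Lℤ)^ν` (`ν ≥ 1`, `L ≥ 2` even) at `m = 0`,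
`|Λ|⁻¹∑_x⟨σ_0σ_x⟩_Λ ≥ (1/4ν)(1/N - 2S_Λ(ν)/N) = (1 - 2S_Λ(ν))/(4νN)`.
[cite: SalmhoferSeiler1991, Thm. 4.8 ((4.41)–(4.42)) with (2.23) and Remark 4.5] -/
theorem uN_chiralLRO_sharp (hν : 1 ≤ ν) (hL : Even L) (hL2 : 2 ≤ L) {N : ℕ} (hN : 1 ≤ N) :
    1 / (4 * ν) * (1 / N - 2 * latticeS ν L / N) ≤
      (Fintype.card (TorusSite ν L) : ℝ)⁻¹ *
        ∑ x : TorusSite ν L, expect N 0 (uNBondCoeff N) (X (0 : TorusSite ν L) * X x) := by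
  have ha : ∀ k ≤ N, 0 ≤ uNBondCoeff N k := fun k _ => uNBondCoeff_nonneg N k
  have hZ : 0 < partitionFunction (ν := ν) (L := L) N 0 (uNBondCoeff N) :=
    partitionFunction_pos hL.two_dvd hL2 hν le_rfl ha (by rw [uNBondCoeff_zero]; exact one_pos)
      (uNBondCoeff_self_pos N)
  have hsd := uN_partitionFunction_le_sharp (ν := ν) (L := L) hN hL2 (le_refl (0 : ℝ)) 0
  rw [mul_zero, zero_mul, zero_add] at hsd
  exact chiralLRO_expect_of_sd hν hL hN ha (fun k hk => uN_fluctCoeff_nonneg hN k hk) hZ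
    (Nat.cast_pos.mpr hN) hsd

/-! ### The thermodynamic form: Cor. 4.9 for every `N` -/

/-- **Thm. 4.8 (4.42) with the printed `S(ν)` and the SD constant as a parameter**: for `ν ≥ 3`,
`a_k ≥ 0`, `b_k ≥ 0`, `a_0, a_N > 0`, and the SD bound `Z_Λ ≤ K ∑_{|y|=1}[σ_0σ_y]_Λ` on every even torus
of side `≥ 2`: for every `ε > 0` and all large even `L`,
`|Λ|⁻¹∑_x⟨σ_0σ_x⟩_Λ ≥ (1/4ν)(1/K - 2S(ν)/N) - ε`. [cite: SalmhoferSeiler1991, Thm. 4.8 (4.42)] -/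
theorem chiralLRO_expect_limit_of_sd (hν : 3 ≤ ν) {N : ℕ} (hN : 1 ≤ N) {a : ℕ → ℝ}
    (ha : ∀ k ≤ N, 0 ≤ a k) (hb : ∀ k ≤ N, 0 ≤ fluctCoeff N a k) (ha0 : 0 < a 0) (haN : 0 < a N)
    {K : ℝ} (hK : 0 < K)
    (hsd : ∀ (L : ℕ) [NeZero L], 2 ≤ L → partitionFunction (ν := ν) (L := L) N 0 a ≤
      K * ∑ s : Fin ν × Bool, bracket N 0 a (X (0 : TorusSite ν L) * X (nbr 0 s)))
    {ε : ℝ} (hε : 0 < ε) :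
    ∃ L₀ : ℕ, ∀ (L : ℕ) [NeZero L], Even L → L₀ ≤ L →
      1 / (4 * ν) * (1 / K - 2 * fluctS ν / N) - ε ≤
        (Fintype.card (TorusSite ν L) : ℝ)⁻¹ *
          ∑ x : TorusSite ν L, expect N 0 a (MvPolynomial.X (0 : TorusSite ν L) * MvPolynomial.X x) := by
  have hν1 : 1 ≤ ν := by omega
  have hνpos : (0 : ℝ) < ν := by exact_mod_cast hν1
  have hNpos : (0 : ℝ) < N := by exact_mod_cast hN
  obtain ⟨L₀, hL₀⟩ := latticeS_tendsto_fluctS (ν := ν) hν hε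
  refine ⟨max L₀ 2, fun L _ hL hLe => ?_⟩
  have hL2 : 2 ≤ L := le_trans (le_max_right _ _) hLe
  have hZ : 0 < partitionFunction (ν := ν) (L := L) N 0 a :=
    partitionFunction_pos hL.two_dvd hL2 hν1 le_rfl ha ha0 haN
  have h1 := chiralLRO_expect_of_sd (ν := ν) (L := L) hν1 hL hN ha hb hZ hK (hsd L hL2)
  have h2 := (abs_le.1 (hL₀ L hL (le_trans (le_max_left _ _) hLe))).2
  refine le_trans ?_ h1
  have hν1' : (1 : ℝ) ≤ ν := by exact_mod_cast hν1
  have hN1' : (1 : ℝ) ≤ N := by exact_mod_cast hN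
  have h3 : 1 / (4 * (ν : ℝ)) * (2 / N) ≤ 1 := by
    rw [div_mul_div_comm, div_le_one (by positivity)]
    have hprod : (1 : ℝ) ≤ (ν : ℝ) * N := by
      nlinarith [mul_nonneg (sub_nonneg.2 hν1') (sub_nonneg.2 hN1')]
    nlinarith [hprod]
  have h4 : 1 / (4 * (ν : ℝ)) * (2 / N) * (latticeS ν L - fluctS ν) ≤ ε := by
    rcases le_or_gt 0 (latticeS ν L - fluctS ν) with hs | hs
    · calc 1 / (4 * (ν : ℝ)) * (2 / N) * (latticeS ν L - fluctS ν)
          ≤ 1 * (latticeS ν L - fluctS ν) := mul_le_mul_of_nonneg_right h3 hs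
        _ ≤ ε := by linarith
    · have : 1 / (4 * (ν : ℝ)) * (2 / N) * (latticeS ν L - fluctS ν) ≤ 0 :=
        mul_nonpos_of_nonneg_of_nonpos (by positivity) hs.le
      linarith
  have h5 : 1 / (4 * (ν : ℝ)) * (1 / K - 2 * fluctS ν / N) - ε
      - 1 / (4 * ν) * (1 / K - 2 * latticeS ν L / N)
      = 1 / (4 * (ν : ℝ)) * (2 / N) * (latticeS ν L - fluctS ν) - ε := by
    field_simp
    ring
  linarith

/-- **Cor. 4.9 for `U(N)`, EVERY `N ≥ 1`, with the printed `S(ν)`**: for `ν ≥ 3`, every `ε > 0` and all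
large even `L`, `|Λ|⁻¹∑_x⟨σ_0σ_x⟩_Λ ≥ (1/4ν)(1/N - 2S(ν)/N) - ε` for the `U(N)` model at `β = 0`,
`m = 0`. [cite: SalmhoferSeiler1991, Cor. 4.9 with Thm. 4.8 (4.42) and (2.23)] -/
theorem uN_chiralLRO_sharp_limit (hν : 3 ≤ ν) {N : ℕ} (hN : 1 ≤ N) {ε : ℝ} (hε : 0 < ε) :
    ∃ L₀ : ℕ, ∀ (L : ℕ) [NeZero L], Even L → L₀ ≤ L →
      1 / (4 * ν) * (1 / N - 2 * fluctS ν / N) - ε ≤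
        (Fintype.card (TorusSite ν L) : ℝ)⁻¹ *
          ∑ x : TorusSite ν L, expect N 0 (uNBondCoeff N)
            (MvPolynomial.X (0 : TorusSite ν L) * MvPolynomial.X x) :=
  chiralLRO_expect_limit_of_sd hν hN (fun k _ => uNBondCoeff_nonneg N k)
    (fun k hk => uN_fluctCoeff_nonneg hN k hk) (by rw [uNBondCoeff_zero]; exact one_pos)
    (uNBondCoeff_self_pos N) (Nat.cast_pos.mpr hN)
    (fun L _ hL2 => by
      have h := uN_partitionFunction_le_sharp (ν := ν) (L := L) hN hL2 (le_refl (0 : ℝ)) 0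
      rwa [mul_zero, zero_mul, zero_add] at h) hε

/-- **COR. 4.9 FOR EVERY `N`: chiral long-range order of the `U(N)` lattice gauge theory at `β = 0` with
one massless staggered fermion (complex-spin form), EVERY `N ≥ 1`, EVERY `ν ≥ 4`, uniformly in the
even volume, with an explicit constant**: `|Λ|⁻¹∑_x⟨σ_0σ_x⟩_Λ ≥ 3/(80νN)` for all large even `L`
(`(1 - 2S(ν))/(4νN) > (1 - 7/10)/(4νN)` by the certified `S(ν) < 7/20`, Prop. 4.2(4)).  Salmhofer–Seiler
state Cor. 4.9 for `N ≤ 4` (and `N = 5`, `ν ≥ 5`); their `K(N)` exceeds `N/(2S(4))` for larger `N`.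
[cite: SalmhoferSeiler1991, Cor. 4.9 with Thm. 4.8 (4.42), (2.23) and Prop. 4.2(4)] -/
theorem uN_chiralLRO_allN_explicit {N : ℕ} (hN : 1 ≤ N) (hν : 4 ≤ ν) :
    ∃ L₀ : ℕ, ∀ (L : ℕ) [NeZero L], Even L → L₀ ≤ L →
      3 / (80 * ν * N) ≤ (Fintype.card (TorusSite ν L) : ℝ)⁻¹ *
          ∑ x : TorusSite ν L, expect N 0 (uNBondCoeff N)
            (MvPolynomial.X (0 : TorusSite ν L) * MvPolynomial.X x) := by
  have hν3 : 3 ≤ ν := by omega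
  have hνpos : (0 : ℝ) < ν := by exact_mod_cast (show 0 < ν by omega)
  have hNpos : (0 : ℝ) < N := by exact_mod_cast hN
  have hS := fluctS_lt_of_four_le hν
  obtain ⟨L₀, hL₀⟩ := uN_chiralLRO_sharp_limit (ν := ν) hν3 hN (ε := 3 / (80 * ν * N)) (by positivity)
  refine ⟨L₀, fun L _ hL hLe => le_trans ?_ (hL₀ L hL hLe)⟩
  -- `3/(80νN) ≤ (1/4ν)(1/N - 2S/N) - 3/(80νN)` iff `S ≤ 7/20`
  have h1 : 1 / (4 * (ν : ℝ)) * (1 / N - 2 * fluctS ν / N) = (1 - 2 * fluctS ν) / (4 * ν * N) := by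
    field_simp
  rw [h1, le_sub_iff_add_le, ← add_div, div_le_div_iff₀ (by positivity) (by positivity)]
  nlinarith [hS, hνpos, hNpos, mul_pos hνpos hNpos]

/-- **COR. 4.9 FOR EVERY `N`** in the form of the tree's `uN_chiralLRO_of_four_le` (there `1 ≤ N ≤ 4`):
for every `N ≥ 1` and `ν ≥ 4` there are `c > 0` and `L₀` with `|Λ|⁻¹∑_x⟨σ_0σ_x⟩_Λ ≥ c` for all even
`L ≥ L₀` — the `U(N)` lattice gauge theory at `β = 0` with one massless staggered fermion has chiral
long-range order in every dimension `ν ≥ 4`, for every number of colours.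
[cite: SalmhoferSeiler1991, Cor. 4.9 with Thm. 4.8 (4.42), (2.23) and Prop. 4.2(4)] -/
theorem uN_chiralLRO_allN {N : ℕ} (hN : 1 ≤ N) (hν : 4 ≤ ν) :
    ∃ c : ℝ, 0 < c ∧ ∃ L₀ : ℕ, ∀ (L : ℕ) [NeZero L], Even L → L₀ ≤ L →
      c ≤ (Fintype.card (TorusSite ν L) : ℝ)⁻¹ *
          ∑ x : TorusSite ν L, expect N 0 (uNBondCoeff N)
            (MvPolynomial.X (0 : TorusSite ν L) * MvPolynomial.X x) := by
  have hνpos : (0 : ℝ) < ν := by exact_mod_cast (show 0 < ν by omega)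
  have hNpos : (0 : ℝ) < N := by exact_mod_cast hN
  obtain ⟨L₀, hL₀⟩ := uN_chiralLRO_allN_explicit (ν := ν) hN hν
  exact ⟨3 / (80 * ν * N), by positivity, L₀, hL₀⟩

end ComplexSpin

end Literature.MathematicalPhysics.StatisticalMechanics

end
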